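import Literature.Analysis.FluidPDE.SteadyNSLiouville
import Literature.Analysis.FluidPDE.LerayProfileCalculus
import HarnessLib

/-!
# Seregin–Wang 2020, Thm 1.1 (i), `q = ℓ = 3`: reduction to the Caccioppoli-type inequality

Analysis/FluidPDE proof file (everything PROVED, no definitions, no named facts) on the discharge
path of the named fact `Literature.Analysis.FluidPDE.sereginWang_liouville_L3_annulus`
(`SteadyNSLiouville.lean`; G. Seregin, W. Wang, *Sufficient conditions on Liouville type theorems
for the 3D steady Navier–Stokes equations*, Algebra i Analiz 31 (2019) = St. Petersburg Math. J.
31 (2020), Thm 1.1 (i) in the case `q = ℓ = 3`; arXiv:1805.02227).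

The printed proof has two layers.  **Proposition 2.1** (ibid., (2.1); Wang 2025, Prop. 2.1,
(2.16)) is the Caccioppoli-type inequality: for every smooth solution `(u, p)` of the steady
system on `ℝ³` and every `R > 0`,

  `∫_{B(R/2)} |∇u|² ≤ C R⁻² ∫_{B_R ∖ B_{R/2}} |u|² + C R^{2 - 9/q} ‖u‖³_{L^{q,ℓ}(B_R ∖ B_{R/2})}`,

which for `q = ℓ = 3`, after Hölder's inequality `R⁻² ∫_{B_R∖B_{R/2}} |u|² ≤ C R⁻¹ ‖u‖²_{L³}`
(ibid., §3, first display), reads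

  `∫_{B(R/2)} |∇u|² ≤ C R⁻¹ (‖u‖²_{L³(B_R ∖ B_{R/2})} + ‖u‖³_{L³(B_R ∖ B_{R/2})})`.      (C₃)

**§3** then passes to the limit `R → ∞` along a sequence realising
`L = lim inf_{R → ∞} M(R)`, `M(R) = R^{-1/3} ‖u‖_{L³(B_R ∖ B_{R/2})}` (note
`R⁻¹ ‖u‖²_{L³} = R^{-1/3} M(R)²`, `R⁻¹ ‖u‖³_{L³} = M(R)³`), obtaining (2.13)
`D(u) = ∫ |∇u|² ≤ c L³`, and (2.14): if `L³ ≤ δ D(u)` with `δ c < 1` then (as `L < ∞`) `L = 0`,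
`D(u) = 0`, `u` is constant, and a non-zero constant has `M(R) ∼ R^{2/3} → ∞`; so `u ≡ 0`.

This file PROVES the second layer:
`sereginWang_liouville_L3_annulus_of_caccioppoli` — **(C₃) for all smooth steady solutions, with
one constant `C`, implies `sereginWang_liouville_L3_annulus`** (with `c = C`, `δ = (C + 1)⁻¹`).
The hypothesis (C₃) is kept as an explicit inline hypothesis (it is proved in the sibling files
of this discharge; it is NOT vendored as a named fact).

## Mathlib / tree search

Mathlib: `Filter.frequently_lt_of_liminf_lt`, `MeasureTheory.lintegral_iSup`,
`MeasureTheory.lintegral_eq_zero_iff`, `Continuous.ae_eq_iff_eq`, `is_const_of_fderiv_eq_zero`,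
`MeasureTheory.eLpNorm_const`, `MeasureTheory.Measure.addHaar_ball`, `ENNReal.tendsto_ofReal_atTop`
(all used).  Tree: `sereginWangL3`, `sereginWang_liouville_L3_annulus` (`SteadyNSLiouville`),
`eq_zero_of_frobeniusNormSq_eq_zero` (`LerayProfileCalculus`), `frobeniusNormSq_nonneg`
(`VectorCalculus`).

## References

* G. Seregin, W. Wang, St. Petersburg Math. J. 31 (2020) 387–393 = Algebra i Analiz 31 (2019),
  no. 2, 269–278 = arXiv:1805.02227: Thm 1.1 (i), Prop. 2.1, §3. [`SereginWang2020`]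
* W. Wang, *Liouville theorems for the steady Navier–Stokes equations* (Science Press, 2025),
  Thm 2.4 (i), Prop. 2.1 (2.16), pp. 34–37. [`Wang2025`]
-/

noncomputable section

namespace Literature.Analysis.FluidPDE

open _root_.MeasureTheory _root_.Filter _root_.Set Metric
open scoped ENNReal NNReal Topology

/-! ### Elementary `ℝ≥0∞` and measure-theoretic lemmas -/

/-- In `ℝ≥0∞`: a finite `x` with `x ≤ a x` for some `a < 1` vanishes. [folklore] -/
theorem ENNReal.eq_zero_of_le_mul_self {x a : ℝ≥0∞} (hx : x ≠ ⊤) (ha : a < 1) (h : x ≤ a * x) :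
    x = 0 := by
  by_contra h0
  have : a * x < 1 * x := ENNReal.mul_lt_mul_left h0 hx ha
  rw [one_mul] at this
  exact absurd h (not_le.2 this)

/-- If the integrals over the balls `B(0, n)` of a measurable `f ≥ 0` are bounded by `K`, so is
the whole integral (monotone convergence). [folklore] -/
theorem lintegral_le_of_forall_setLIntegral_ball_le {f : (EuclideanSpace ℝ (Fin 3)) → ℝ≥0∞} (hf : Measurable f)
    {K : ℝ≥0∞} (h : ∀ n : ℕ, ∫⁻ x in ball (0 : (EuclideanSpace ℝ (Fin 3))) n, f x ≤ K) : ∫⁻ x, f x ≤ K := by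
  set g : ℕ → (EuclideanSpace ℝ (Fin 3)) → ℝ≥0∞ := fun n => (ball (0 : (EuclideanSpace ℝ (Fin 3))) n).indicator f with hg
  have hgm : ∀ n, Measurable (g n) := fun n => hf.indicator measurableSet_ball
  have hmono : Monotone g := by
    intro m n hmn x
    simp only [hg]
    exact indicator_le_indicator_of_subset (ball_subset_ball (by exact_mod_cast hmn))
      (fun _ => bot_le) x
  have hsup : (fun x => ⨆ n, g n x) = f := by
    funext x
    apply le_antisymm
    · exact iSup_le fun n => indicator_le_self _ _ x
    · obtain ⟨n, hn⟩ := exists_nat_gt ‖x‖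
      refine le_iSup_of_le n ?_
      simp only [hg]
      rw [indicator_of_mem (by simpa using hn)]
  calc ∫⁻ x, f x = ∫⁻ x, ⨆ n, g n x := by rw [hsup]
    _ = ⨆ n, ∫⁻ x, g n x := lintegral_iSup hgm hmono
    _ ≤ K := iSup_le fun n => by
        simp only [hg]
        rw [lintegral_indicator measurableSet_ball]
        exact h n

/-- The annulus `{R/2 ≤ |x| < R}` contains the ball of radius `R/8` about any point of norm
`3R/4`. [folklore] -/
theorem ball_subset_sereginWang_annulus {R : ℝ} (hR : 0 < R) {c : (EuclideanSpace ℝ (Fin 3))} (hc : ‖c‖ = 3 * R / 4) :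
    ball c (R / 8) ⊆ {x : (EuclideanSpace ℝ (Fin 3)) | R / 2 ≤ ‖x‖ ∧ ‖x‖ < R} := by
  intro x hx
  rw [mem_ball, dist_eq_norm] at hx
  have h := abs_norm_sub_norm_le x c
  rw [abs_le] at h
  obtain ⟨h1, h2⟩ := h
  constructor
  · linarith
  · linarith

/-- A non-zero vector of norm `3R/4` in `(EuclideanSpace ℝ (Fin 3))`. [folklore] -/
theorem exists_norm_eq_sereginWang (R : ℝ) (hR : 0 ≤ R) : ∃ c : (EuclideanSpace ℝ (Fin 3)), ‖c‖ = 3 * R / 4 := by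
  obtain ⟨e, he⟩ : ∃ e : (EuclideanSpace ℝ (Fin 3)), ‖e‖ = 1 := exists_norm_eq (EuclideanSpace ℝ (Fin 3)) zero_le_one
  refine ⟨(3 * R / 4) • e, ?_⟩
  rw [norm_smul, he, mul_one, Real.norm_eq_abs, abs_of_nonneg (by positivity)]

/-- **A non-zero constant field has `lim inf M(R) = ∞`.**  For `u ≡ a ≠ 0`,
`M(R) = R^{-1/3} |a| |B_R ∖ B_{R/2}|^{1/3} ≥ |a| |B₁|^{1/3} R^{2/3} / 8 → ∞` (the annulus
contains a ball of radius `R/8`). This is the last step of the printed proof of (2.14)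
(Seregin–Wang 2020, §3: finiteness of `lim inf M` forces the constant to vanish). [folklore] -/
theorem liminf_sereginWangL3_const {a : (EuclideanSpace ℝ (Fin 3))} (ha : a ≠ 0) :
    liminf (sereginWangL3 (fun _ : (EuclideanSpace ℝ (Fin 3)) => a)) atTop = ⊤ := by
  -- the reference volume
  set V : ℝ≥0∞ := volume (ball (0 : (EuclideanSpace ℝ (Fin 3))) 1) with hV
  have hV0 : V ≠ 0 := (measure_ball_pos volume (0 : (EuclideanSpace ℝ (Fin 3))) one_pos).ne'
  have hVtop : V ≠ ⊤ := measure_ball_lt_top.ne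
  -- the lower bound `g R = |a| V^{1/3} ofReal (R^{2/3} / 8) ≤ M(R)` for `R > 0`
  set K : ℝ≥0∞ := ‖a‖ₑ * V ^ (1 / 3 : ℝ) with hK
  have hK0 : K ≠ 0 := mul_ne_zero (by simpa using ha) (by
    simp [ENNReal.rpow_eq_zero_iff, hV0, hVtop])
  have hKtop : K ≠ ⊤ := ENNReal.mul_ne_top enorm_ne_top
    (ENNReal.rpow_ne_top_of_nonneg (by norm_num) hVtop)
  set g : ℝ → ℝ≥0∞ := fun R => K * ENNReal.ofReal (R ^ (2 / 3 : ℝ) / 8) with hg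
  have hle : ∀ᶠ R in atTop, g R ≤ sereginWangL3 (fun _ : (EuclideanSpace ℝ (Fin 3)) => a) R := by
    filter_upwards [eventually_gt_atTop 0] with R hR
    obtain ⟨c, hc⟩ := exists_norm_eq_sereginWang R hR.le
    have hsub := ball_subset_sereginWang_annulus hR hc
    set A : Set (EuclideanSpace ℝ (Fin 3)) := {x : (EuclideanSpace ℝ (Fin 3)) | R / 2 ≤ ‖x‖ ∧ ‖x‖ < R} with hA
    -- volume of the small ball
    have hball : volume (ball c (R / 8)) = ENNReal.ofReal ((R / 8) ^ 3) * V := by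
      rw [hV, Measure.addHaar_ball volume c (by positivity : (0 : ℝ) ≤ R / 8)]
      simp [finrank_euclideanSpace]
    have hAvol : ENNReal.ofReal ((R / 8) ^ 3) * V ≤ volume A := by
      rw [← hball]; exact measure_mono hsub
    have hμA : volume.restrict A ≠ 0 := by
      intro h0
      have : volume A = 0 := by
        have := congrArg (fun μ : Measure (EuclideanSpace ℝ (Fin 3)) => μ univ) h0
        simpa [Measure.restrict_apply_univ] using this
      rw [this, nonpos_iff_eq_zero, mul_eq_zero] at hAvol
      rcases hAvol with h | h
      · have : (0 : ℝ) < (R / 8) ^ 3 := by positivity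
        rw [ENNReal.ofReal_eq_zero] at h
        linarith
      · exact hV0 h
    -- the `L³` norm of the constant on the annulus
    have hnorm : eLpNorm (fun _ : (EuclideanSpace ℝ (Fin 3)) => a) 3 (volume.restrict A) =
        ‖a‖ₑ * (volume A) ^ (1 / 3 : ℝ) := by
      rw [eLpNorm_const a (by norm_num) hμA, Measure.restrict_apply_univ]
      norm_num
    -- compare
    show g R ≤ sereginWangL3 (fun _ : (EuclideanSpace ℝ (Fin 3)) => a) R
    simp only [sereginWangL3, hg]
    rw [hnorm]
    have h13 : (ENNReal.ofReal ((R / 8) ^ 3) * V) ^ (1 / 3 : ℝ) ≤ (volume A) ^ (1 / 3 : ℝ) :=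
      ENNReal.rpow_le_rpow hAvol (by norm_num)
    have hsplit : (ENNReal.ofReal ((R / 8) ^ 3) * V) ^ (1 / 3 : ℝ) =
        ENNReal.ofReal (R / 8) * V ^ (1 / 3 : ℝ) := by
      rw [ENNReal.mul_rpow_of_nonneg _ _ (by norm_num : (0 : ℝ) ≤ 1 / 3),
        ENNReal.ofReal_rpow_of_nonneg (by positivity) (by norm_num), ← Real.rpow_natCast,
        ← Real.rpow_mul (by positivity)]
      norm_num
    have hpow : ENNReal.ofReal (R ^ (2 / 3 : ℝ) / 8) =
        ENNReal.ofReal (R ^ (-(1 / 3 : ℝ))) * ENNReal.ofReal (R / 8) := by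
      rw [← ENNReal.ofReal_mul (Real.rpow_nonneg hR.le _)]
      congr 1
      rw [div_eq_mul_inv R 8, ← mul_assoc, ← Real.rpow_add_one hR.ne']
      norm_num
      rw [div_eq_mul_one_div]
    calc K * ENNReal.ofReal (R ^ (2 / 3 : ℝ) / 8)
        = ENNReal.ofReal (R ^ (-(1 / 3 : ℝ))) * (‖a‖ₑ * (ENNReal.ofReal (R / 8) * V ^ (1 / 3 : ℝ))) := by
          rw [hpow, hK]; ring
      _ ≤ ENNReal.ofReal (R ^ (-(1 / 3 : ℝ))) * (‖a‖ₑ * (volume A) ^ (1 / 3 : ℝ)) := by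
          rw [← hsplit]
          gcongr
  -- `g R → ∞`
  have hg_top : Tendsto g atTop (𝓝 ⊤) := by
    have h1 : Tendsto (fun R : ℝ => R ^ (2 / 3 : ℝ) / 8) atTop atTop :=
      (tendsto_rpow_atTop (by norm_num)).atTop_div_const (by norm_num)
    have h2 : Tendsto (fun R : ℝ => ENNReal.ofReal (R ^ (2 / 3 : ℝ) / 8)) atTop (𝓝 ⊤) :=
      ENNReal.tendsto_ofReal_atTop.comp h1
    have h3 := ENNReal.Tendsto.const_mul h2 (Or.inr hKtop) (a := K)
    rwa [ENNReal.mul_top hK0] at h3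
  -- conclude
  refine eq_top_iff.2 ?_
  calc (⊤ : ℝ≥0∞) = liminf g atTop := hg_top.liminf_eq.symm
    _ ≤ liminf (sereginWangL3 (fun _ : (EuclideanSpace ℝ (Fin 3)) => a)) atTop := liminf_le_liminf hle

/-- Rewriting the right-hand side of (C₃) in terms of `M(R) = R^{-1/3} ‖u‖_{L³(B_R∖B_{R/2})}`:
`R⁻¹ (N² + N³) = R^{-1/3} M² + M³` where `N = ‖u‖_{L³(B_R∖B_{R/2})}` (Seregin–Wang 2020, §3,
first display). [cite: SereginWang2020, §3] -/
theorem ofReal_inv_mul_eLpNorm_annulus_eq (u : (EuclideanSpace ℝ (Fin 3)) → (EuclideanSpace ℝ (Fin 3))) {R : ℝ} (hR : 0 < R) :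
    ENNReal.ofReal R⁻¹ *
        (eLpNorm u 3 (volume.restrict {x : (EuclideanSpace ℝ (Fin 3)) | R / 2 ≤ ‖x‖ ∧ ‖x‖ < R}) ^ 2 +
          eLpNorm u 3 (volume.restrict {x : (EuclideanSpace ℝ (Fin 3)) | R / 2 ≤ ‖x‖ ∧ ‖x‖ < R}) ^ 3) =
      ENNReal.ofReal (R ^ (-(1 / 3 : ℝ))) * sereginWangL3 u R ^ 2 + sereginWangL3 u R ^ 3 := by
  set N := eLpNorm u 3 (volume.restrict {x : (EuclideanSpace ℝ (Fin 3)) | R / 2 ≤ ‖x‖ ∧ ‖x‖ < R}) with hN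
  have hρ : ∀ s : ℝ, ENNReal.ofReal (R ^ s) ≠ 0 := fun s => by
    rw [ne_eq, ENNReal.ofReal_eq_zero, not_le]; exact Real.rpow_pos_of_pos hR s
  simp only [sereginWangL3]
  rw [← hN, mul_pow, mul_pow, ← mul_assoc, ← ENNReal.ofReal_pow (Real.rpow_nonneg hR.le _),
    ← ENNReal.ofReal_pow (Real.rpow_nonneg hR.le _),
    ← ENNReal.ofReal_mul (Real.rpow_nonneg hR.le _), ← Real.rpow_natCast, ← Real.rpow_natCast,
    ← Real.rpow_mul hR.le, ← Real.rpow_mul hR.le, ← Real.rpow_add hR, mul_add]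
  have e1 : (-(1 / 3 : ℝ)) + -(1 / 3 : ℝ) * ((2 : ℕ) : ℝ) = -1 := by norm_num
  have e2 : -(1 / 3 : ℝ) * ((3 : ℕ) : ℝ) = -1 := by norm_num
  rw [e1, e2, Real.rpow_neg_one]

/-! ### The reduction -/

/-- **Seregin–Wang 2020, Thm 1.1 (i) for `q = ℓ = 3`, from the Caccioppoli-type inequality
(Prop. 2.1 / Wang 2025 (2.16), case `q = ℓ = 3`).**  If one constant `C` gives, for every smooth
solution `(u, p)` of the steady Navier–Stokes system on `(EuclideanSpace ℝ (Fin 3))` (`IsLerayProfile 1 0 u p`, `u`, `p`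
smooth) and every `R > 0`,
`∫_{B(R/2)} |∇u|² ≤ C R⁻¹ (‖u‖²_{L³(B_R∖B_{R/2})} + ‖u‖³_{L³(B_R∖B_{R/2})})`, then
`sereginWang_liouville_L3_annulus` holds with `c = C` and `δ = (C + 1)⁻¹`: this is §3 of the
paper (pass `R → ∞` along a sequence realising the `lim inf`), followed by the elementary
last step of (2.14) (`D ≤ cδ D`, `cδ < 1`, `D < ∞` force `D = 0`, so `u` is constant, and a
non-zero constant has `lim inf M = ∞`). [cite: SereginWang2020, Thm 1.1 (i) and §3] -/
theorem sereginWang_liouville_L3_annulus_of_caccioppoli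
    (hC : ∃ C : ℝ≥0, ∀ (u : (EuclideanSpace ℝ (Fin 3)) → (EuclideanSpace ℝ (Fin 3))) (p : (EuclideanSpace ℝ (Fin 3)) → ℝ), IsLerayProfile 1 0 u p →
      ContDiff ℝ (⊤ : ℕ∞) u → ContDiff ℝ (⊤ : ℕ∞) p → ∀ R : ℝ, 0 < R →
        (∫⁻ x in ball (0 : (EuclideanSpace ℝ (Fin 3))) (R / 2), ENNReal.ofReal (frobeniusNormSq (fderiv ℝ u x))) ≤
          C * (ENNReal.ofReal R⁻¹ *
            (eLpNorm u 3 (volume.restrict {x : (EuclideanSpace ℝ (Fin 3)) | R / 2 ≤ ‖x‖ ∧ ‖x‖ < R}) ^ 2 +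
              eLpNorm u 3 (volume.restrict {x : (EuclideanSpace ℝ (Fin 3)) | R / 2 ≤ ‖x‖ ∧ ‖x‖ < R}) ^ 3))) :
    sereginWang_liouville_L3_annulus := by
  obtain ⟨C, hC⟩ := hC
  refine ⟨C, (C + 1)⁻¹, by positivity, fun u p hprof hu hp hL => ?_⟩
  -- notation
  set M : ℝ → ℝ≥0∞ := sereginWangL3 u with hM
  set L : ℝ≥0∞ := liminf M atTop with hLdef
  set f : (EuclideanSpace ℝ (Fin 3)) → ℝ≥0∞ := fun x => ENNReal.ofReal (frobeniusNormSq (fderiv ℝ u x)) with hf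
  have hLtop : L ≠ ⊤ := hL.ne
  -- regularity of the integrand
  have hu1 : ContDiff ℝ 1 u := contDiff_infty.1 hu 1
  have hDu : Continuous (fderiv ℝ u) := hu1.continuous_fderiv one_ne_zero
  have hFc : Continuous fun L : (EuclideanSpace ℝ (Fin 3)) →L[ℝ] (EuclideanSpace ℝ (Fin 3)) => frobeniusNormSq L := by
    unfold frobeniusNormSq
    exact continuous_finsetSum _ fun i _ =>
      ((ContinuousLinearMap.apply ℝ (EuclideanSpace ℝ (Fin 3)) (stdOrthonormalBasis ℝ (EuclideanSpace ℝ (Fin 3)) i)).continuous.norm).pow 2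
  have hfc : Continuous fun x => frobeniusNormSq (fderiv ℝ u x) := hFc.comp hDu
  have hfm : Measurable f := ENNReal.measurable_ofReal.comp hfc.measurable
  -- the Caccioppoli bound in terms of `M`
  have hcacc : ∀ R : ℝ, 0 < R →
      ∫⁻ x in ball (0 : (EuclideanSpace ℝ (Fin 3))) (R / 2), f x ≤
        C * (ENNReal.ofReal (R ^ (-(1 / 3 : ℝ))) * M R ^ 2 + M R ^ 3) := fun R hR => by
    have := hC u p hprof hu hp R hR
    rwa [ofReal_inv_mul_eLpNorm_annulus_eq u hR] at this
  -- Step 1 (2.13): `D ≤ C b³` for every finite `b > L`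
  have hstep : ∀ b : ℝ≥0∞, L < b → b ≠ ⊤ → ∫⁻ x, f x ≤ C * b ^ 3 := by
    intro b hLb hbtop
    have hfreq : ∃ᶠ R in atTop, M R < b := frequently_lt_of_liminf_lt (by isBoundedDefault) hLb
    -- for every `R₀ > 0`: `D ≤ C (R₀^{-1/3} b² + b³)`
    have hbound : ∀ R₀ : ℝ, 0 < R₀ →
        ∫⁻ x, f x ≤ C * (ENNReal.ofReal (R₀ ^ (-(1 / 3 : ℝ))) * b ^ 2 + b ^ 3) := by
      intro R₀ hR₀
      refine lintegral_le_of_forall_setLIntegral_ball_le hfm fun n => ?_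
      obtain ⟨R, hRb, hRge⟩ :=
        (hfreq.and_eventually (eventually_ge_atTop (max R₀ (2 * n)))).exists
      have hRb' : M R ≤ b := hRb.le
      have hR₀R : R₀ ≤ R := le_trans (le_max_left _ _) hRge
      have hR : 0 < R := lt_of_lt_of_le hR₀ hR₀R
      have hnR : (n : ℝ) ≤ R / 2 := by
        have := le_trans (le_max_right _ _) hRge
        linarith
      calc ∫⁻ x in ball (0 : (EuclideanSpace ℝ (Fin 3))) n, f x ≤ ∫⁻ x in ball (0 : (EuclideanSpace ℝ (Fin 3))) (R / 2), f x :=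
            lintegral_mono_set (ball_subset_ball hnR)
        _ ≤ C * (ENNReal.ofReal (R ^ (-(1 / 3 : ℝ))) * M R ^ 2 + M R ^ 3) := hcacc R hR
        _ ≤ C * (ENNReal.ofReal (R₀ ^ (-(1 / 3 : ℝ))) * b ^ 2 + b ^ 3) := by
            have h1 : ENNReal.ofReal (R ^ (-(1 / 3 : ℝ))) ≤ ENNReal.ofReal (R₀ ^ (-(1 / 3 : ℝ))) :=
              ENNReal.ofReal_le_ofReal
                (Real.rpow_le_rpow_of_nonpos hR₀ hR₀R (by norm_num))
            gcongr
    -- let `R₀ → ∞`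
    have htend : Tendsto (fun R₀ : ℝ => C * (ENNReal.ofReal (R₀ ^ (-(1 / 3 : ℝ))) * b ^ 2 + b ^ 3))
        atTop (𝓝 (C * (0 * b ^ 2 + b ^ 3))) := by
      have h1 : Tendsto (fun R₀ : ℝ => R₀ ^ (-(1 / 3 : ℝ))) atTop (𝓝 0) :=
        tendsto_rpow_neg_atTop (by norm_num)
      have h2 : Tendsto (fun R₀ : ℝ => ENNReal.ofReal (R₀ ^ (-(1 / 3 : ℝ)))) atTop (𝓝 0) := by
        have := ENNReal.tendsto_ofReal h1
        rwa [ENNReal.ofReal_zero] at this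
      have h3 : Tendsto (fun R₀ : ℝ => ENNReal.ofReal (R₀ ^ (-(1 / 3 : ℝ))) * b ^ 2) atTop
          (𝓝 (0 * b ^ 2)) :=
        ENNReal.Tendsto.mul_const h2 (Or.inr (ENNReal.pow_ne_top hbtop))
      have h4 := h3.add_const (b ^ 3)
      exact ENNReal.Tendsto.const_mul h4 (Or.inr ENNReal.coe_ne_top)
    rw [zero_mul, zero_add] at htend
    refine ge_of_tendsto htend ?_
    filter_upwards [eventually_gt_atTop 0] with R₀ hR₀ using hbound R₀ hR₀
  -- Step 1 concluded: `D ≤ C L³`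
  have hD : ∫⁻ x, f x ≤ C * L ^ 3 := by
    set b : ℕ → ℝ≥0∞ := fun n => L + ((n + 1 : ℕ) : ℝ≥0∞)⁻¹ with hb
    have hbn : ∀ n : ℕ, L < b n := fun n =>
      ENNReal.lt_add_right hLtop (ENNReal.inv_ne_zero.2 (ENNReal.natCast_ne_top _))
    have hbn' : ∀ n : ℕ, b n ≠ ⊤ := fun n =>
      ENNReal.add_ne_top.2 ⟨hLtop, ENNReal.inv_ne_top.2 (by positivity)⟩
    have h1 : Tendsto b atTop (𝓝 (L + 0)) :=
      tendsto_const_nhds.add (ENNReal.tendsto_inv_nat_nhds_zero.comp (tendsto_add_atTop_nat 1))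
    rw [add_zero] at h1
    have h2 : Tendsto (fun n : ℕ => (C : ℝ≥0∞) * b n ^ 3) atTop (𝓝 (C * L ^ 3)) :=
      ENNReal.Tendsto.const_mul (((ENNReal.continuous_pow 3).tendsto L).comp h1)
        (Or.inr ENNReal.coe_ne_top)
    exact ge_of_tendsto' h2 fun n => hstep _ (hbn n) (hbn' n)
  refine ⟨hD, fun hsmall => ?_⟩
  -- Step 2 (2.14): `L³ ≤ δ D ≤ δ C L³` with `δ C < 1` forces `L = 0`, `D = 0`
  have hL3top : L ^ 3 ≠ ⊤ := ENNReal.pow_ne_top hLtop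
  have hδC : ((C + 1)⁻¹ : ℝ≥0) * C < 1 := by
    rw [inv_mul_lt_iff₀ (by positivity)]
    simp
  have hL0 : L ^ 3 = 0 := by
    refine ENNReal.eq_zero_of_le_mul_self hL3top (a := ((C + 1)⁻¹ : ℝ≥0) * C) ?_ ?_
    · exact_mod_cast hδC
    · calc L ^ 3 ≤ ((C + 1)⁻¹ : ℝ≥0) * ∫⁻ x, f x := hsmall
        _ ≤ ((C + 1)⁻¹ : ℝ≥0) * (C * L ^ 3) := by gcongr
        _ = (((C + 1)⁻¹ : ℝ≥0) * C : ℝ≥0) * L ^ 3 := by push_cast; ring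
  have hD0 : ∫⁻ x, f x = 0 := by
    have := hD
    rw [hL0, mul_zero] at this
    exact le_antisymm this bot_le
  -- `∇u ≡ 0`, so `u` is constant
  have hae : f =ᵐ[volume] 0 := (lintegral_eq_zero_iff hfm).1 hD0
  have hf0 : f = 0 := by
    have hfc' : Continuous f := ENNReal.continuous_ofReal.comp hfc
    exact (hfc'.ae_eq_iff_eq volume continuous_const).1 hae
  have hgrad : ∀ x, fderiv ℝ u x = 0 := fun x => by
    have h1 : f x = 0 := by rw [hf0]; rfl
    simp only [hf, ENNReal.ofReal_eq_zero] at h1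
    exact eq_zero_of_frobeniusNormSq_eq_zero (le_antisymm h1 (frobeniusNormSq_nonneg _))
  have hconst : ∀ x, u x = u 0 := fun x =>
    is_const_of_fderiv_eq_zero (hu1.differentiable one_ne_zero) hgrad x 0
  -- a non-zero constant is excluded by `L < ∞`
  by_contra hne
  have ha : u 0 ≠ 0 := by
    intro h0
    apply hne
    funext x
    rw [hconst x, h0]; rfl
  have hu_eq : u = fun _ => u 0 := funext hconst
  have := liminf_sereginWangL3_const ha
  rw [← hu_eq] at this
  exact hLtop this

end Literature.Analysis.FluidPDE

end
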